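import Summits.AnomalousDissipation.AnomalousDissipation.Theses.EnsembleRigidity
import HarnessLib

/-!
# `EnsembleRigidity.GPTameDefectFloor` (stmt-AnomalousDissipation-17938) — negative side:
# the pointwise matrix bound of `stub_gpEnergyPointwise` is tight to `11/700`

Negative lemma of the disprover seat (cdisprove) on the stub `stub_gpEnergyPointwise` of line `Sketch`
(lead c1, skeleton v9, `Cruxes/GPTameDefectFloor/Lines/Sketch.lean`); supports
`stmt-AnomalousDissipation-17938`, proves no `Theses` statement.

The stub asserts, for all real `X Y Z v₀ v₁ v₂`,
`0 ≤ (143/100)(v₀² + v₁² + v₂²) + 2(a v₀v₁ + b v₀v₂ + c v₁v₂)` with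
`a = cos X + (7/20)(cos Y cos Z − sin X sin Z)`, `b = cos Z + (7/20)(cos X cos Y − sin Y sin Z)`,
`c = cos Y + (7/20)(cos X cos Z − sin X sin Y)` — the pointwise strain bound behind the two-shell energy
certificate `w = f_GP + (7/20)·lambMode` (region `E ≤ 1/3` of the crux T).

* `not_gpEnergyPointwise_at_141` — the same inequality with `141/100` in place of `143/100` is FALSE:
  at `X = arccos(5/7)`, `Y = π − X`, `Z = −X` one has `(a, b, c) = (99/140, 99/140, −99/140)`, and at
  `v = (1, −1, −1)` the form is `3·(141/100) − 594/140 = −9/700 < 0`. So the least admissible constant lies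
  in `[99/70, 143/100]`: the stub's margin is at most `11/700 ≈ 0.0157` (its docstring claims exactly this
  extremiser; a grid + Newton search of the seat found no smaller eigenvalue than `−99/70`, i.e. the stub
  itself survived). Any SOS certificate for the stub must therefore be exact to better than `1.1 %`.
* `gpEnergyPointwise_margin_at_extremiser` — at that point the stub's own form equals `33/700 ≥ 0`.

[folklore]
-/

set_option linter.dupNamespace false

namespace Summit.AnomalousDissipation.AnomalousDissipation.Theorems.GPTameDefectFloor.Negative

/-- **`stub_gpEnergyPointwise` with `141/100` is false** (witness `X = arccos(5/7)`, `Y = π − X`, `Z = −X`,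
`v = (1, −1, −1)`; value `−9/700`). -/
theorem not_gpEnergyPointwise_at_141 : ¬ ∀ X Y Z v₀ v₁ v₂ : ℝ, 0 ≤ 141 / 100 * (v₀ ^ 2 + v₁ ^ 2 + v₂ ^ 2) +
      2 * ((Real.cos X + 7 / 20 * (Real.cos Y * Real.cos Z - Real.sin X * Real.sin Z)) * (v₀ * v₁) +
        (Real.cos Z + 7 / 20 * (Real.cos X * Real.cos Y - Real.sin Y * Real.sin Z)) * (v₀ * v₂) +
        (Real.cos Y + 7 / 20 * (Real.cos X * Real.cos Z - Real.sin X * Real.sin Y)) * (v₁ * v₂)) := by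
  intro h
  set s : ℝ := Real.arccos (5 / 7) with hs
  have hc : Real.cos s = 5 / 7 := by
    rw [hs, Real.cos_arccos] <;> norm_num
  have hσ : Real.sin s ^ 2 = 24 / 49 := by
    rw [Real.sin_sq, hc]; norm_num
  have key := h s (Real.pi - s) (-s) 1 (-1) (-1)
  rw [Real.cos_pi_sub, Real.sin_pi_sub, Real.cos_neg, Real.sin_neg, hc] at key
  nlinarith [key, hσ]

/-- At the extremiser the stub's own form (constant `143/100`, entries `±99/140`) equals `33/700 ≥ 0`. -/
theorem gpEnergyPointwise_margin_at_extremiser :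
    0 ≤ 143 / 100 * ((1 : ℝ) ^ 2 + (-1) ^ 2 + (-1) ^ 2) +
      2 * ((99 / 140 : ℝ) * (1 * -1) + (99 / 140 : ℝ) * (1 * -1) + (-(99 / 140) : ℝ) * (-1 * -1)) := by
  norm_num

end Summit.AnomalousDissipation.AnomalousDissipation.Theorems.GPTameDefectFloor.Negative
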